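import Mathlib
import HarnessLib
import Summits.HubbardSuperconductivity.HubbardSuperconductivity.Theorems.KLProgrammeKLRegimeTwoLegReadOscConsts

/-!
# K3 ENGINE child (stmt-HubbardSuperconductivity-20437), stub (b) (ℓ)/(I1′): the (K5′) constant slot and the one U-door of the «(F1)-JOIN+W2» chain —
# from (b)'s registered history clause `∀ m, 1 ≤ m → m < n → FlowPieceOscAt … (klReadOscC P R) … m` to the chain's `c″ := max (klReadOscC P R) 1 > 0`,
# and the door `c″·U ≤ 1` from `U ≤ 1/(klReadOscC P R + 1)` (pen (R190), AMENDMENT 21 to `klEngU₀12`: its last min-entry)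

Cell `gate-hubbard-kl`, seat hubbard-kl-k3c3-p2 (g12).  The window-free (I1′) `klWtPinnedSumAt_klTowerIncr_le_klEng_all (d) (R) (c″) (hc″ : 0 < c″)`
(…EngineTowerBlockIncrWtKlEngAll) and its α / cr-cc suppliers take a constant `c″ > 0`, the (K5′) clauses with that constant, and the door `c″·U ≤ 1`.
Stub (b) (rev 14) supplies the clauses with `klReadOscC P R ≥ 0` (…TwoLegReadOscConsts) and, after AMENDMENT 21, `U ≤ klEngU₀12 P R c ≤ 1/(klReadOscC P R + 1)`.
This file is the two-line bridge, stated against `klReadOscC` and an abstract door `U ≤ 1/(klReadOscC P R + 1)` (the extraction from `klEngU₀12` is one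
`le_trans` with `klEngU₀12_le_inv_klReadOscC` once …EngineV8DefsU12b is filed):

* `max_klReadOscC_one_pos` — `0 < max (klReadOscC P R) 1` (the `hc″` of the chain);
* `flowPieceOscAt_hist_max_klReadOscC` — (b)'s clauses ⇒ the clauses with `c″ := max (klReadOscC P R) 1` (`FlowPieceOscAt.mono`);
* `max_klReadOscC_mul_le_one` — `0 ≤ U ≤ 1/(klReadOscC P R + 1)` ⇒ `c″·U ≤ 1`.

Everything is proved; no definitions; nothing about the model is asserted; nothing asserts superconductivity. [cite: BenfattoGiulianiMastropietro2006, §2.4 (2.36)]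
-/

noncomputable section

namespace Summit.HubbardSuperconductivity.HubbardSuperconductivity.Theorems.KLRegimeSplit

set_option linter.dupNamespace false -- summit = problem name (single-conjunct summit), D-0017

open Real Literature.MathematicalPhysics.QuantumLattice Literature.Probability.LatticeModels
open Literature.MathematicalPhysics.QuantumLattice.FermiRG

/-- **The chain's constant is positive**: `0 < max (klReadOscC P R) 1`. [folklore] -/
theorem max_klReadOscC_one_pos (P : SplitConsts) (R : RenConsts) : 0 < max (klReadOscC P R) 1 :=
  lt_of_lt_of_le one_pos (le_max_right _ _)

/-- **(b)'s registered (K5′) clauses ⇒ the clauses with the chain's constant** `max (klReadOscC P R) 1` (monotonicity in the constant).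
[cite: BenfattoGiulianiMastropietro2006, §2.4 (2.36)] -/
theorem flowPieceOscAt_hist_max_klReadOscC {L M : ℕ} [NeZero L] [NeZero M] {P : SplitConsts} {R : RenConsts} {β U μ : ℝ} {n : ℕ}
    (h : ∀ m, 1 ≤ m → m < n → FlowPieceOscAt L M (klReadOscC P R) β U μ m) :
    ∀ m, 1 ≤ m → m < n → FlowPieceOscAt L M (max (klReadOscC P R) 1) β U μ m := fun m h1 hm =>
  (h m h1 hm).mono (le_max_left _ _)

/-- **The one U-door of the chain**: `0 ≤ U ≤ 1/(klReadOscC P R + 1)` ⇒ `max (klReadOscC P R) 1 · U ≤ 1`. [folklore] -/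
theorem max_klReadOscC_mul_le_one {P : SplitConsts} {R : RenConsts} {U : ℝ} (hU : 0 ≤ U) (hUd : U ≤ 1 / (klReadOscC P R + 1)) :
    max (klReadOscC P R) 1 * U ≤ 1 := by
  have hc : 0 ≤ klReadOscC P R := klReadOscC_nonneg P R
  have hmax : max (klReadOscC P R) 1 ≤ klReadOscC P R + 1 := max_le (by linarith) (by linarith)
  have hpos : 0 < klReadOscC P R + 1 := by linarith
  calc max (klReadOscC P R) 1 * U ≤ (klReadOscC P R + 1) * (1 / (klReadOscC P R + 1)) :=
        mul_le_mul hmax hUd hU hpos.le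
    _ = 1 := by field_simp

end Summit.HubbardSuperconductivity.HubbardSuperconductivity.Theorems.KLRegimeSplit

end
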